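import Summits.QuantumFields.YangMills.Theorems.PoincareLipschitzGapOfHSystemQuantizationOfTransport
import Summits.QuantumFields.YangMills.Theorems.PoincareLipschitzConeLinkTransport
import Summits.QuantumFields.YangMills.Theorems.PoincareLipschitzHistoryTailOfGap
import HarnessLib

/-!
# Crux `BlockLipschitzL` (stmt-QuantumFields-23533) ∕ `HistoryTailL` (stmt-QuantumFields-19936), LINE 25 «CompactnessTransfer»,
# the (TM) road, ROAD (H) «SU(2) CURRENTS ⇒ H-SYSTEM ⇒ 8π QUANTUM» — THE CLOSER: «(GAP) ⟸ THE H-SYSTEM QUANTUM ALONE», hence S1″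

Cell `ym3-torus` (YM ladder rung R3 = continuum SU(2) Yang–Mills on T³ — a RUNG, NOT Clay: not d = 4, not infinite volume,
not a mass gap); WIDTH helper seat `ym3-torus-px19` g8 (road memo `ROAD-TM-HSYSTEM-px19g8.md`, 23533 evidence);
`--supports stmt-QuantumFields-23533`; THEOREMS ONLY (0 `def`, 0 `sorry`, default heartbeats); imports this seat's
✓`…GapOfHSystemQuantizationOfTransport` ((GAP) ⟸ (F) ∧ (T)-door: the K-DOOR over ✓(Q-J), ✓(Q)×2 with px5 g9's ✓H5
`…PlanarStreamFunctionBundle.doorH` discharging the (H)-door), px14 g7 ∕ px16 g10's ✓(T) `…ConeLinkTransport.exists_link_of_linear_energies`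
(cone → plane transport; rows by px16 (A1–A3, D-EN), px14 (B, C, D1–D4, DOOR), px19 (D-CL)) — and LEAD ★w1-19936 g10's ✓`…HistoryTailOfGap` (`BlockLipschitzL ⟸ (GAP)`, over px3 g9's S1″ ⟸ (GAP)).

WHAT THIS FILE PROVES.
* ★★★★ `gap_of_hSystemQuantization (hF : Literature.Analysis.PDE.HSystemEnergyQuantization) : ⟨(GAP)⟩` — px3 g9's FROZEN (GAP)
  binder text (sha16 30a3f4556be5a68a) «a map of the minimising class `Q → S³` with LINEAR central ball energies `E(B_r(0)) = Θ·r`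
  (`r ≤ 1∕2`) and `Θ ≤ 3π` has `Θ = 0`» — the `8π` ENERGY GAP OF MINIMIZING TANGENT MAPS `ℝ³ → S³`, from ONE named printed fact,
  the energy quantum of the H-system [BrezisCoron1985, Lemma A.1 = Lemma 0.1], replacing [SchoenUhlenbeck1984, Prop. 1.2 ∕ Lemma 1.1]:
  no harmonic-map regularity (Hélein, SU82) is used anywhere on the road.
* ★★★ `blockLipschitzL_of_hSystemQuantization (hF) : Theses.PoincareLipschitz.BlockLipschitzL` := LEAD ★w1-19936 g10's
  ✓`PoincareLipschitzHistoryTailOfGap.blockLipschitzL_of_gap (gap_of_hSystemQuantization hF)` — THE K2 CRUX stmt-QuantumFields-23533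
  MODULO ONE NAMED PRINTED FACT [BrezisCoron1985, Lemma A.1] (secondary reading; LEAD's K2-lane face is the display of record).
HONEST SCOPE.  (GAP) and S1″ become theorems MODULO the named printed fact (F) = `HSystemEnergyQuantization`; (F) itself is NOT
proved here (Wente's regularity + the classification of H-bubbles are inside it); K1, `MeanDeviationL`, `BlockLipschitzL` (LEAD's face),
`HistoryTailL` NOT proved here.  YM₃ on T³ is rung R3, not Clay; YM gap NOT proved; no summit statement is proved here.

References: H. Brezis, J.-M. Coron, Arch. Rational Mech. Anal. 89 (1985) 21–56 [BrezisCoron1985] (Appendix, Lemma A.1; Lemma 0.1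
p. 22); R. Schoen, K. Uhlenbeck, Invent. Math. 78 (1984) 89–100 [SchoenUhlenbeck1984] (Lemma 1.1, Prop. 1.2 — re-derived for
`Θ ≤ 3π`); K. Uhlenbeck, J. Differential Geom. 30 (1989) 1–50 (harmonic maps into Lie groups — the `SU(2)` structure used).
-/

set_option autoImplicit false

noncomputable section

open MeasureTheory Set Function Filter Topology Metric TopologicalSpace
open scoped ContDiff ENNReal BigOperators RealInnerProductSpace

namespace Summit.QuantumFields.YangMills.Theorems.PoincareLipschitzGapOfHSystemQuantizationCloses

open Literature.Analysis.FunctionSpaces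
open Summit.QuantumFields.YangMills.Theorems.PoincareLipschitzGapOfHSystemQuantizationOfTransport (gap_of_hSystemQuantization_of_transport)

/-- ★★★★ **THE `8π` GAP OF MINIMIZING TANGENT MAPS `ℝ³ → S³` FROM THE H-SYSTEM ENERGY QUANTUM** — px3 g9's (GAP) binder
(sha16 30a3f4556be5a68a) VERBATIM, from the single named printed fact `HSystemEnergyQuantization` [BrezisCoron1985, Lemma A.1]:
the `SU(2)` currents of the link are a finite-energy weak H-system after Hodge (bricks (T), (Q), (H)), so `Θ ∈ 8πℕ`, and `Θ ≤ 3π`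
forces `Θ = 0`. [cite: BrezisCoron1985, Appendix, Lemma A.1; SchoenUhlenbeck1984, Lemma 1.1 and Proposition 1.2] -/
theorem gap_of_hSystemQuantization (hF : Literature.Analysis.PDE.HSystemEnergyQuantization) :
    ∀ (hQ : IsOpen {x : EuclideanSpace ℝ (Fin 3) | ∀ i : Fin 3, |x i| < 1}) (U : EuclideanSpace ℝ (Fin 3) → EuclideanSpace ℝ (Fin 4)) (G : EuclideanSpace ℝ (Fin 3) → (EuclideanSpace ℝ (Fin 3) →L[ℝ] EuclideanSpace ℝ (Fin 4))),
      (HasWeakFDerivOn ⟨{x : EuclideanSpace ℝ (Fin 3) | ∀ i : Fin 3, |x i| < 1}, hQ⟩ volume U G ∧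
        (∀ x : EuclideanSpace ℝ (Fin 3), (∀ i : Fin 3, |x i| < 1) → ‖U x‖ = 1) ∧
        IntegrableOn (fun x => ∑ i : Fin 3, ‖G x (EuclideanSpace.single i (1:ℝ))‖ ^ 2) {x : EuclideanSpace ℝ (Fin 3) | ∀ i : Fin 3, |x i| < 1} ∧
        (∀ (y : EuclideanSpace ℝ (Fin 3)) (ρ : ℝ), 0 < ρ → closedBall y ρ ⊆ {x : EuclideanSpace ℝ (Fin 3) | ∀ i : Fin 3, |x i| < 1} →
          ∀ (W : EuclideanSpace ℝ (Fin 3) → EuclideanSpace ℝ (Fin 4)) (GW : EuclideanSpace ℝ (Fin 3) → (EuclideanSpace ℝ (Fin 3) →L[ℝ] EuclideanSpace ℝ (Fin 4))),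
          HasWeakFDerivOn ⟨{x : EuclideanSpace ℝ (Fin 3) | ∀ i : Fin 3, |x i| < 1}, hQ⟩ volume W GW →
          (∀ x : EuclideanSpace ℝ (Fin 3), (∀ i : Fin 3, |x i| < 1) → ‖W x‖ = 1) →
          IntegrableOn (fun x => ∑ i : Fin 3, ‖GW x (EuclideanSpace.single i (1:ℝ))‖ ^ 2) {x : EuclideanSpace ℝ (Fin 3) | ∀ i : Fin 3, |x i| < 1} →
          (∃ ρ' : ℝ, ρ' < ρ ∧ ∀ x : EuclideanSpace ℝ (Fin 3), x ∉ ball y ρ' → W x = U x) →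
          ∫ x in ball y ρ, ∑ i : Fin 3, ‖G x (EuclideanSpace.single i (1:ℝ))‖ ^ 2 ≤ ∫ x in ball y ρ, ∑ i : Fin 3, ‖GW x (EuclideanSpace.single i (1:ℝ))‖ ^ 2)) →
      ∀ Θ : ℝ, (∀ r : ℝ, 0 < r → r ≤ 1 / 2 → ∫ x in ball (0 : EuclideanSpace ℝ (Fin 3)) r, ∑ i : Fin 3, ‖G x (EuclideanSpace.single i (1:ℝ))‖ ^ 2 = Θ * r) →
        Θ ≤ 3 * Real.pi → Θ = 0 :=
  gap_of_hSystemQuantization_of_transport hF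
    Summit.QuantumFields.YangMills.Theorems.PoincareLipschitzConeLinkTransport.exists_link_of_linear_energies

/-- ★★★ **THE K2 CRUX `BlockLipschitzL` (stmt-QuantumFields-23533) MODULO THE H-SYSTEM ENERGY QUANTUM ALONE** — LEAD's
✓`blockLipschitzL_of_gap` fed with ✓`gap_of_hSystemQuantization` (secondary reading of the K2-lane face).
[cite: BrezisCoron1985, Appendix, Lemma A.1; Luckhaus1988, Thm 2] -/
theorem blockLipschitzL_of_hSystemQuantization (hF : Literature.Analysis.PDE.HSystemEnergyQuantization) :
    Summit.QuantumFields.YangMills.Theses.PoincareLipschitz.BlockLipschitzL :=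
  Summit.QuantumFields.YangMills.Theorems.PoincareLipschitzHistoryTailOfGap.blockLipschitzL_of_gap
    (gap_of_hSystemQuantization hF)

end Summit.QuantumFields.YangMills.Theorems.PoincareLipschitzGapOfHSystemQuantizationCloses
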